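import Mathlib.RepresentationTheory.Subrepresentation
import Mathlib.RepresentationTheory.Intertwining
import HarnessLib

/-!
# Transport of subrepresentations and intertwining maps along an equivalence of representations

Topic `RepresentationTheory`; namespace `Literature.RepresentationTheory` (declarations in the Mathlib namespaces
`Representation` / `Subrepresentation` / `Representation.IntertwiningMap` for dot notation).  Plumbing
DEFINITIONS + API (reviewed kind); no named fact, no instance, no notation, no `sorry`.

Equivalent representations have "the same" subrepresentations, irreducible constituents and intertwining maps
[Bump1997, §4.2: «if `(π, V)` and `(π', V')` are equivalent … we may identify»]; [SerreLinearRepresentations1977,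
§1.2 (isomorphic representations)].  Mathlib has `Representation.Equiv`, `Subrepresentation`,
`Representation.IntertwiningMap` but (as of the tree's toolchain) no transport API between them; this file
supplies the elementary pieces used by the lattice argument for tame principal-series types
(`FiniteGroups/GL2ModularPrincipalSeriesLattice*`), where a representation must be moved to a carrier with
well-behaved typeclass instances:

* `Representation.transport ρ e` — `g ↦ e ∘ ρ(g) ∘ e⁻¹` on the target of a linear equivalence `e`, and
  `Representation.transportEquiv : ρ ≃ ρ.transport e`;
* `Representation.Equiv.apply_apply_eq` — `e (ρ g v) = σ g (e v)` (pointwise intertwining);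
* **`Subrepresentation.mapEquiv e : Subrepresentation ρ ≃o Subrepresentation σ`** (`X ↦ e(X)`) with membership
  lemmas, and `Subrepresentation.equivMapEquiv e X : X ≃ e(X)` (the restricted equivalence);
* `Representation.IntertwiningMap.codRestrictSub` — corestriction of an intertwining map to a subrepresentation
  containing its image.
-/

noncomputable section

namespace Literature.RepresentationTheory

open Function

section Transport

variable {A : Type*} [CommSemiring A] {G' : Type*} [Monoid G'] {V' W' : Type*} [AddCommMonoid V'] [AddCommMonoid W']
  [Module A V'] [Module A W'] (ρ' : Representation A G' V')

/-- **Transport of a representation along a linear equivalence** `e : V ≃ W`: `g ↦ e ∘ ρ(g) ∘ e⁻¹`. [cite: Bump1997, §4.2] -/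
def _root_.Representation.transport (e : V' ≃ₗ[A] W') : Representation A G' W' where
  toFun g := e.conj (ρ' g)
  map_one' := by rw [map_one]; exact LinearEquiv.conj_id e
  map_mul' g h := by rw [map_mul]; exact LinearEquiv.conj_comp e (ρ' h) (ρ' g)

/-- Unfolding / transport lemma `transport_apply`. [cite: Bump1997, §4.2] -/
@[simp]
theorem _root_.Representation.transport_apply (e : V' ≃ₗ[A] W') (g : G') (w : W') :
    ρ'.transport e g w = e (ρ' g (e.symm w)) := rfl

/-- The transporting equivalence is an equivalence of representations `ρ ≃ ρ.transport e`. [cite: Bump1997, §4.2] -/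
def _root_.Representation.transportEquiv (e : V' ≃ₗ[A] W') : ρ'.Equiv (ρ'.transport e) :=
  Representation.Equiv.mk e fun g => by
    refine LinearMap.ext fun v => ?_
    simp

/-- Unfolding / transport lemma `transportEquiv_apply`. [cite: Bump1997, §4.2] -/
@[simp]
theorem _root_.Representation.transportEquiv_apply (e : V' ≃ₗ[A] W') (v : V') :
    ρ'.transportEquiv e v = e v := rfl

/-- Unfolding / transport lemma `transportEquiv_symm_apply`. [cite: Bump1997, §4.2] -/
@[simp]
theorem _root_.Representation.transportEquiv_symm_apply (e : V' ≃ₗ[A] W') (w : W') :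
    (ρ'.transportEquiv e).symm w = e.symm w := rfl

variable {ρ'} {σ' : Representation A G' W'}

/-- An equivalence of representations intertwines the actions (pointwise form). [cite: Bump1997, §4.2] -/
theorem _root_.Representation.Equiv.apply_apply_eq (e : ρ'.Equiv σ') (g : G') (v : V') :
    e (ρ' g v) = σ' g (e v) :=
  LinearMap.congr_fun (e.isIntertwining' g) v

/-- **Subrepresentations transported along an equivalence of representations** (`X ↦ e(X)`), an order
isomorphism. [cite: Bump1997, §4.2] -/
def _root_.Subrepresentation.mapEquiv (e : ρ'.Equiv σ') : Subrepresentation ρ' ≃o Subrepresentation σ' where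
  toFun X := ⟨X.toSubmodule.map (e.toLinearEquiv : V' →ₗ[A] W'), by
    rintro g w ⟨v, hv, rfl⟩
    refine ⟨ρ' g v, X.apply_mem_toSubmodule g hv, ?_⟩
    exact e.apply_apply_eq g v⟩
  invFun Y := ⟨Y.toSubmodule.comap (e.toLinearEquiv : V' →ₗ[A] W'), by
    intro g v hv
    change e (ρ' g v) ∈ Y
    rw [e.apply_apply_eq g v]
    exact Y.apply_mem_toSubmodule g hv⟩
  left_inv X := by
    ext v
    change v ∈ (X.toSubmodule.map (e.toLinearEquiv : V' →ₗ[A] W')).comap (e.toLinearEquiv : V' →ₗ[A] W') ↔ _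
    rw [Submodule.comap_map_eq_of_injective e.toLinearEquiv.injective]
  right_inv Y := by
    ext w
    change w ∈ (Y.toSubmodule.comap (e.toLinearEquiv : V' →ₗ[A] W')).map (e.toLinearEquiv : V' →ₗ[A] W') ↔ _
    rw [Submodule.map_comap_eq_of_surjective e.toLinearEquiv.surjective]
  map_rel_iff' := by
    intro X X'
    change X.toSubmodule.map _ ≤ X'.toSubmodule.map _ ↔ _
    rw [Submodule.map_le_map_iff_of_injective e.toLinearEquiv.injective]
    rfl

/-- Unfolding / transport lemma `mapEquiv_toSubmodule`. [cite: Bump1997, §4.2] -/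
theorem _root_.Subrepresentation.mapEquiv_toSubmodule (e : ρ'.Equiv σ') (X : Subrepresentation ρ') :
    (Subrepresentation.mapEquiv e X).toSubmodule = X.toSubmodule.map (e.toLinearEquiv : V' →ₗ[A] W') := rfl

/-- Unfolding / transport lemma `mem_mapEquiv_iff`. [cite: Bump1997, §4.2] -/
theorem _root_.Subrepresentation.mem_mapEquiv_iff (e : ρ'.Equiv σ') (X : Subrepresentation ρ') (w : W') :
    w ∈ Subrepresentation.mapEquiv e X ↔ e.symm w ∈ X := by
  change w ∈ X.toSubmodule.map (e.toLinearEquiv : V' →ₗ[A] W') ↔ _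
  rw [Submodule.mem_map_equiv]
  rfl

/-- Unfolding / transport lemma `mem_mapEquiv_symm_iff`. [cite: Bump1997, §4.2] -/
theorem _root_.Subrepresentation.mem_mapEquiv_symm_iff (e : ρ'.Equiv σ') (Y : Subrepresentation σ') (v : V') :
    v ∈ (Subrepresentation.mapEquiv e).symm Y ↔ e v ∈ Y := Iff.rfl

/-- Unfolding / transport lemma `apply_mem_mapEquiv`. [cite: Bump1997, §4.2] -/
theorem _root_.Subrepresentation.apply_mem_mapEquiv (e : ρ'.Equiv σ') (X : Subrepresentation ρ') {v : V'}
    (hv : v ∈ X) : e v ∈ Subrepresentation.mapEquiv e X :=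
  ⟨v, hv, rfl⟩

/-- The equivalence restricted to a subrepresentation: `X ≃ e(X)`. [cite: Bump1997, §4.2] -/
def _root_.Subrepresentation.equivMapEquiv (e : ρ'.Equiv σ') (X : Subrepresentation ρ') :
    X.toRepresentation.Equiv (Subrepresentation.mapEquiv e X).toRepresentation :=
  Representation.Equiv.mk
    (e.toLinearEquiv.submoduleMap X.toSubmodule) fun g => by
      refine LinearMap.ext fun x => Subtype.ext ?_
      exact e.apply_apply_eq g (x : V')

/-- Unfolding / transport lemma `coe_equivMapEquiv_apply`. [cite: Bump1997, §4.2] -/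
@[simp]
theorem _root_.Subrepresentation.coe_equivMapEquiv_apply (e : ρ'.Equiv σ') (X : Subrepresentation ρ')
    (x : X.toSubmodule) :
    ((Subrepresentation.equivMapEquiv e X x : (Subrepresentation.mapEquiv e X).toSubmodule) : W') = e x := rfl

end Transport

section CodRestrict

/-- **Corestriction of an intertwining map** to a subrepresentation containing its image. [cite: Bump1997, §4.2] -/
def _root_.Representation.IntertwiningMap.codRestrictSub {A : Type*} [CommSemiring A] {G' : Type*} [Monoid G']
    {V' W' : Type*} [AddCommMonoid V'] [AddCommMonoid W'] [Module A V'] [Module A W']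
    {ρ' : Representation A G' V'} {σ' : Representation A G' W'} (f : ρ'.IntertwiningMap σ')
    (Y : Subrepresentation σ') (hf : ∀ v, f v ∈ Y) : ρ'.IntertwiningMap Y.toRepresentation where
  toLinearMap := f.toLinearMap.codRestrict Y.toSubmodule hf
  isIntertwining' g := by
    refine LinearMap.ext fun v => Subtype.ext ?_
    exact LinearMap.congr_fun (f.isIntertwining' g) v

/-- Underlying values of the corestriction. [cite: Bump1997, §4.2] -/
theorem _root_.Representation.IntertwiningMap.coe_codRestrictSub_apply {A : Type*} [CommSemiring A]
    {G' : Type*} [Monoid G'] {V' W' : Type*} [AddCommMonoid V'] [AddCommMonoid W'] [Module A V'] [Module A W']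
    {ρ' : Representation A G' V'} {σ' : Representation A G' W'} (f : ρ'.IntertwiningMap σ')
    (Y : Subrepresentation σ') (hf : ∀ v, f v ∈ Y) (v : V') :
    ((f.codRestrictSub Y hf v : Y.toSubmodule) : W') = f v := rfl

end CodRestrict

end Literature.RepresentationTheory
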